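import Summits.QuantumFields.BalabanUV.T4Continuum.Spine.NE5.TwoRunTorusRate
import Summits.QuantumFields.BalabanUV.T4Continuum.Spine.NE5.TwoRunTorusParam
import Summits.QuantumFields.BalabanUV.T4Continuum.Spine.NE5.TwoRunTorusWalkParam

/-!
# Spine/NE5/TwoRunTorusWalkOutput — the torus chain's OUTPUT `E^b(X)` holomorphic in ANY complex parameter with (2.41)
# uniform, the (2.14)-terms READ FROM PER-TERM WALK RECORDS at `c⁺` (cell `pub-balaban-gaps`, seat `ne5` gen 9)

WHY.  T17 `TwoRunTorusParam.differentiableOn_E_torus_param` is the joint (seam, pencil) statement rows (D4) and NE5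
consume on the papers' periodic carrier: per-term families `b ↦ P Z t φ b` holomorphic on an open `V` with (2.26)
uniform (`hPhol`, `h226`) + Lemma 3's and (2.39)–(2.41)'s numbers ⇒ `b ↦ E^b(X)(φ)` holomorphic on `V` with
`‖E^b(X)(φ)‖ ≤ A₂C₃ε₁e^{−(1−10δ)½Lκd_{k+1}(X)}`.  T25 `TwoRunTorusWalkParam.hol_and_h226_torus_of_termWalkData_param`
supplies `hPhol ∧ h226` for ONE term from ONE walk record `TermKernels c⁺ … B` with `TermWalkData` (the (D4) walk
road's objects, junction (J1)+(J2) closed at `c⁺`) plus the non-walk data.  THIS FILE is the composition at the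
family level: `differentiableOn_E_torus_of_termWalkData` — per term `(Z, t)` and configuration `φ ∈ sp2 Z` a walk
record `𝒦 Z t φ` over the parameter space `B` with walk objects for ONE admissible package `w` (NODE O's bookkeeping
statement (v): `∃w ∀terms`, `B13TermWalkData.ExistsWalkDataUniform`), the non-walk data per term (σ-holomorphy,
symmetry ∕ `Re ≻ 0`, potentials with (2.20), common `χ, χᶜ, 𝐃` with (2.22), column fibre bound), ONE package of rates and
p. 17 numerics in the record's letters, the outputs by (2.13) per member, the space restriction p. 15, and Lemma 3's ∕
(2.39)–(2.41)'s numbers verbatim ⇒ T17's conclusion on `V = ball 0 α`.  Read with `B = E` (backgrounds) this is row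
(D4)'s NODE A input «activities holomorphic along the background seam with Lemma 3» from walk records; read with
`B = E × ℂ` or `B = ℂ` (NE5's two-run pencil at a scale, window `α = s∕r_j > 1`) the Schwarz step
`TwoRunTorusRate.norm_sub_le_of_pencil` turns it into NE5's inequality at one paired scale (§2,
`torus_rates_of_output_pencil`: the one-run envelopes at the members `0`, `1` and `‖E^1(X) − E^0(X)‖ ≤
(2∕α)·A₂C₃ε₁e^{−(1−10δ)½Lκd_{k+1}(X)}`), i.e. the three per-scale inputs of T16 `TwoRunTorusNE5.ne5_of_torus_rates`.

HONEST FRAMING.  Pure composition of LANDED ∕ staged shapes (T17; T25; T14 §1); every record, family, region and number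
is a HYPOTHESIS; nothing of Bałaban's is constructed or asserted; whether Bałaban's operators admit `TermWalkData` with
printed constants is NODE O's statement (v), not claimed; NE5 NOT PRINTED ∕ NOT PROVED; leaves 0∕12; (D4) 0∕1; spine
0∕9.  Rung (B)+1 on a FIXED finite T⁴ — NOT continuum, NOT infinite volume, NOT mass gap, NOT Clay.  HONEST
DEPENDENCY: continuum YM on T⁴ ⇐ BetaPertH ∧ nine spine estimates; BetaPertH ⇐ (D1) ∧ (D4) ∧ CAP+tail.  0 sorry, 0 `def`.

Sources: [II] = T. Bałaban, CMP **116** (1988) [Balaban1988RG2Cluster] (2.13) p. 14, (2.14)–(2.26) pp. 15–17, Lemma 3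
(2.38) p. 20, (2.41) p. 21; [B9] = CMP **99** (1985) [Balaban1985BackgroundPropagators] Thm 3.10 p. 416; C. King, CMP
**102** (1986) [King1986] Thm 3.4 p. 656, p. 665.  Nothing here is a claim about the Yang–Mills mass gap.
-/

noncomputable section

namespace Summit.QuantumFields.BalabanUV.T4Continuum.Spine.NE5.TwoRunTorusWalkOutput

open Matrix Metric Set Finset
open Literature.MathematicalPhysics.QuantumFieldTheory.Balaban1983to89
open Literature.MathematicalPhysics.QuantumFieldTheory.Balaban1983to89.TreeLengthTorus (TPt TDom tsys)
open Literature.MathematicalPhysics.QuantumFieldTheory.Balaban1983to89.TreeLengthTorusGeometry (TTouch)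
open Literature.MathematicalPhysics.QuantumFieldTheory.Balaban1983to89.TreeLengthTorusTransfer (tclosure)
open Literature.MathematicalPhysics.QuantumFieldTheory.Balaban1983to89.B13Lemma3TorusData (TBond)
open Literature.MathematicalPhysics.QuantumFieldTheory.Balaban1983to89.B13Lemma3Torus (TwoTorusStep)
open Literature.MathematicalPhysics.QuantumFieldTheory.Balaban1983to89.B13Lemma3TorusTerms (terms weight Z0)
open Literature.MathematicalPhysics.QuantumFieldTheory.Balaban1983to89.B13Term214 (core214 F214 term214)
open Literature.MathematicalPhysics.QuantumFieldTheory.Balaban1983to89.B13Bound143 (invTau)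
open Literature.MathematicalPhysics.QuantumFieldTheory.Balaban1983to89.B5TorusCover (UT)
open Literature.MathematicalPhysics.QuantumFieldTheory.Balaban1983to89.B12TreeDecay (kappa₀ K₀)
open Literature.MathematicalPhysics.QuantumFieldTheory.Balaban1983to89.B13Resummation (locE)
open Literature.MathematicalPhysics.QuantumFieldTheory.Balaban1983to89.B13TermWalkData
  (WalkConsts TermKernels TermWalkData)
open Literature.MathematicalPhysics.QuantumFieldTheory.Balaban1983to89.B13TermWalkDataOneTorus (SmallTheta)
open Summit.QuantumFields.BalabanUV.T4Continuum.Spine.NE5.TwoRunTorusParam (differentiableOn_E_torus_param)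
open Summit.QuantumFields.BalabanUV.T4Continuum.Spine.NE5.TwoRunTorusRate (norm_sub_le_of_pencil)
open Summit.QuantumFields.BalabanUV.T4Continuum.Spine.NE5.TwoRunTorusWalkParam
  (hol_and_h226_torus_of_termWalkData_param)

variable {L N' : ℕ} [NeZero L] [NeZero N'] {M : ℕ} [NeZero M]
variable {ν : ℕ} {Nf : Fin ν → ℕ} [∀ i, NeZero (Nf i)]
variable {B : Type*} [NormedAddCommGroup B] [NormedSpace ℂ B]

/-! ## §1. The output along any parameter from per-term walk records -/

open Classical in
/-- **THE TORUS CHAIN'S OUTPUT ALONG ANY PARAMETER FROM PER-TERM WALK RECORDS AT `c⁺`.**  Data per term `(Z, t)`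
(`t ∈ terms L M Z`) and configuration `φ ∈ sp2 Z`: a walk record `𝒦 Z t φ : TermKernels c⁺ 4 N' ν Nf B` over the
parameter space `B` with `TermWalkData (𝒦 Z t φ) w` for ONE package `w` admissible at size `α > 0`; the Γ-operator
linear with the record's kernel; σ-holomorphy of the record's kernels on the open `e^{κ₁+1}`-polydisc, symmetry and
`Re ≻ 0` on the closed one × the closed `α`-ball; potentials holomorphic in `b`, measurable, with (2.20) on `Π_Y Uτ Y`
uniformly; common `χ, χᶜ, 𝐃` with (2.22); column fibre bounds; ONE package of rates `w.κ > κ_a > κ_b > κ′ > κ″ > 0` and p. 17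
numerics in the record's letters with NODE A's `SmallTheta w α θ` BY NAME (as in T25); the outputs `H^b(Z) = Σ_t (2.14)-term`, `E^b(X)` by (2.13) per member,
the space restriction, and Lemma 3's ∕ (2.39)–(2.41)'s numbers verbatim as in T17.  Conclusion: for every `X` and
`φ ∈ sp2 X`, `b ↦ E^b(X)(φ)` is `DifferentiableOn ℂ` on `ball 0 α` and `‖E^b(X)(φ)‖ ≤ A₂C₃ε₁e^{−(1−10δ)½Lκd_{k+1}(X)}`
there — T17 fed by T25 per term.
[cite: Balaban1988RG2Cluster, (2.13) p.14, (2.14)–(2.26) pp.15–17, (2.38) p.20, (2.41) p.21; Balaban1985BackgroundPropagators, Thm 3.10 p.416; King1986, p.665] -/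
theorem differentiableOn_E_torus_of_termWalkData (c : B13.Consts) (hL : 8 ≤ c.L) (hLc : c.L = L) (hκ₁ : 1 ≤ c.κ₁)
    (hα₆' : c.α₆ ≠ 0) (W : TwoTorusStep 4 L N')
    -- regions, radii, contour radius, parameter lists (common to the family)
    (hpos : ∀ Y : TDom 4 (L * N'), 0 < invTau c ((tsys 4 (L * N')).dj Y))
    (hhalf : ∀ Y : TDom 4 (L * N'), invTau c ((tsys 4 (L * N')).dj Y) ≤ 1 / 2)
    {Uτ : TDom 4 (L * N') → Set ℂ} (hUτ : ∀ Y, IsOpen (Uτ Y))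
    (hUtau : ∀ Y : TDom 4 (L * N'), closedBall (0 : ℂ) ((invTau c ((tsys 4 (L * N')).dj Y))⁻¹) ⊆ Uτ Y)
    {r : ℝ} (hr : 0 < r) (hr' : r ≤ Real.exp c.κ₁ - 1)
    (hsubτ : ∀ Y, ∀ s ∈ Set.uIcc (0 : ℝ) 1, closedBall (s : ℂ) r ⊆ Uτ Y)
    (lZ : TDom 4 N' → Finset (TDom 4 (L * N')) × Finset (TBond 4 M (L * N')) → List (TPt 4 N'))
    (hlZ : ∀ Z t, (lZ Z t).Nodup ∧ (lZ Z t).toFinset = Z.1 \ tclosure L N' (Z0 M t))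
    (lD : Finset (TDom 4 (L * N')) × Finset (TBond 4 M (L * N')) → List (TDom 4 (L * N')))
    (hlD : ∀ t, (lD t).Nodup ∧ (lD t).toFinset = t.1)
    -- PER-TERM WALK RECORDS AT `c⁺` OVER THE PARAMETER SPACE, ONE ADMISSIBLE PACKAGE
    (𝒦 : (Z : TDom 4 N') → Finset (TDom 4 (L * N')) × Finset (TBond 4 M (L * N')) → W.Φ →
      TermKernels ({ c with κ₁ := c.κ₁ + 1 } : B13.Consts) 4 N' ν Nf B)
    [∀ Z t φ, Fintype (𝒦 Z t φ).C₀] [∀ Z t φ, DecidableEq (𝒦 Z t φ).C₀]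
    {w : WalkConsts} {α Rσ₀ : ℝ} (hw : w.Admissible α Rσ₀) (hα : 0 < α)
    (h𝒦 : ∀ Z, ∀ t ∈ terms L M Z, ∀ φ, φ ∈ W.sp2 Z → TermWalkData (𝒦 Z t φ) w)
    (Γ : (Z : TDom 4 N') → (t : Finset (TDom 4 (L * N')) × Finset (TBond 4 M (L * N'))) → (φ : W.Φ) → B →
      (TPt 4 N' → ℂ) → ((𝒦 Z t φ).Λ ⊕ (𝒦 Z t φ).C₀ → ℝ) → ((𝒦 Z t φ).Λ → ℂ))
    (hlin : ∀ Z, ∀ t ∈ terms L M Z, ∀ φ, φ ∈ W.sp2 Z → ∀ b ∈ ball (0 : B) α, ∀ σ : TPt 4 N' → ℂ,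
      (∀ j, σ j ∈ ball (0 : ℂ) (Real.exp (c.κ₁ + 1))) →
        ∀ X : (𝒦 Z t φ).Λ ⊕ (𝒦 Z t φ).C₀ → ℝ, Γ Z t φ b σ X = (𝒦 Z t φ).G2 σ b *ᵥ fun j => (X j : ℂ))
    (χY₀ χcP : (Z : TDom 4 N') → (t : Finset (TDom 4 (L * N')) × Finset (TBond 4 M (L * N'))) → (φ : W.Φ) →
      ((𝒦 Z t φ).Λ → ℝ) → ℝ)
    (hχ0 : ∀ Z t φ Bf, 0 ≤ χY₀ Z t φ Bf) (hχc0 : ∀ Z t φ Bf, 0 ≤ χcP Z t φ Bf)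
    (Dfam : TDom 4 N' → Finset (TDom 4 (L * N')) × Finset (TBond 4 M (L * N')) → Finset (TDom 4 (L * N')))
    (Vk : (Z : TDom 4 N') → (t : Finset (TDom 4 (L * N')) × Finset (TBond 4 M (L * N'))) → (φ : W.Φ) → B →
      TDom 4 (L * N') → ((𝒦 Z t φ).Λ → ℝ) → ℂ)
    -- non-walk data: σ-holomorphy, symmetry ∕ `Re ≻ 0`, potentials, measurability
    (hAhol : ∀ Z, ∀ t ∈ terms L M Z, ∀ φ, φ ∈ W.sp2 Z → ∀ b ∈ ball (0 : B) α, ∀ i j,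
      DifferentiableOn ℂ (fun σ => (𝒦 Z t φ).A2 σ b i j) {σ | ∀ j, σ j ∈ ball (0 : ℂ) (Real.exp (c.κ₁ + 1))})
    (hGhol : ∀ Z, ∀ t ∈ terms L M Z, ∀ φ, φ ∈ W.sp2 Z → ∀ b ∈ ball (0 : B) α, ∀ i j,
      DifferentiableOn ℂ (fun σ => (𝒦 Z t φ).G2 σ b i j) {σ | ∀ j, σ j ∈ ball (0 : ℂ) (Real.exp (c.κ₁ + 1))})
    (hVholb : ∀ Z, ∀ t ∈ terms L M Z, ∀ φ, φ ∈ W.sp2 Z → ∀ Y Bf,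
      DifferentiableOn ℂ (fun b => Vk Z t φ b Y Bf) (ball (0 : B) α))
    (hχm : ∀ Z t φ, Measurable (χY₀ Z t φ)) (hχcm : ∀ Z t φ, Measurable (χcP Z t φ))
    (hVm : ∀ Z, ∀ t ∈ terms L M Z, ∀ φ, φ ∈ W.sp2 Z → ∀ b ∈ ball (0 : B) α, ∀ Y, Measurable (Vk Z t φ b Y))
    (hAs : ∀ Z, ∀ t ∈ terms L M Z, ∀ φ, φ ∈ W.sp2 Z → ∀ b : B, ‖b‖ ≤ α → ∀ σ : TPt 4 N' → ℂ,
      (∀ j, ‖σ j‖ ≤ Real.exp (c.κ₁ + 1)) → ((𝒦 Z t φ).A2 σ b).IsSymm)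
    (hA : ∀ Z, ∀ t ∈ terms L M Z, ∀ φ, φ ∈ W.sp2 Z → ∀ b : B, ‖b‖ ≤ α → ∀ σ : TPt 4 N' → ℂ,
      (∀ j, ‖σ j‖ ≤ Real.exp (c.κ₁ + 1)) → (((𝒦 Z t φ).A2 σ b).map Complex.re).PosDef)
    -- (2.22) and (2.20), uniform along the parameter
    {γ₂ rP a₂₀ w₂₀ : ℝ}
    (qP : (Z : TDom 4 N') → (t : Finset (TDom 4 (L * N')) × Finset (TBond 4 M (L * N'))) → (φ : W.Φ) →
      ((𝒦 Z t φ).Λ → ℝ) → ℝ)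
    (h222 : ∀ Z t φ Bf, χY₀ Z t φ Bf * χcP Z t φ Bf ≤
      Real.exp (-(γ₂ / 2 * rP ^ 2 * (t.2.card : ℕ)) + γ₂ / 2 * qP Z t φ Bf))
    (hγ₂ : 0 ≤ γ₂) (hqP : ∀ Z t φ Bf, qP Z t φ Bf ≤ Bf ⬝ᵥ Bf) (ha0 : 0 ≤ a₂₀)
    (h220U : ∀ Z, ∀ t ∈ terms L M Z, ∀ φ, φ ∈ W.sp2 Z → ∀ b ∈ ball (0 : B) α, ∀ τ : TDom 4 (L * N') → ℂ,
      (∀ Y, τ Y ∈ Uτ Y) → ∀ Bf, ∑ Y ∈ Dfam Z t, ‖τ Y‖ * ‖Vk Z t φ b Y Bf‖ ≤ a₂₀ / 2 * (Bf ⬝ᵥ Bf) + w₂₀)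
    -- a common fibre bound
    {m : ℕ} (hm : ∀ Z t φ, (𝒦 Z t φ).m ≤ m)
    (hfibN : ∀ Z t φ, ∀ x : UT Nf, (Finset.univ.filter fun j => (𝒦 Z t φ).locN j = x).card ≤ m)
    -- one package of rates and p. 17 numerics in the record's letters
    {κa κb kap' kap'' θ : ℝ} (hκa : κa < w.kap) (hκb : κb < κa) (h2 : kap' < κb) (h1 : kap'' < kap')
    (hkap'' : 0 < kap'')
    (hsm : SmallTheta w α θ)
    (hθR1le : ∀ Z t φ, ((m : ℝ) * (1 + 2 / (κb - kap')) ^ ν) * (m * (1 + 2 / (kap' - kap'')) ^ ν)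
      * ((2 * w.KbarΓ * Real.exp (-(w.ε * w.Rσ)) + 2 * w.KbarΓ * α / w.R) * w.KbarC * w.KbarΓ
        + w.KbarΓ * (w.KbarC * (2 * w.KbarE * Real.exp (-(w.ε * w.Rσ)) + 2 * w.KbarE * α / w.R)
            * ((𝒦 Z t φ).m * (1 + 2 / (w.kap - κa)) ^ ν) * w.KbarC * ((𝒦 Z t φ).m * (1 + 2 / (κa - κb)) ^ ν))
            * w.KbarΓ
        + w.KbarΓ * w.KbarC * (2 * w.KbarΓ * Real.exp (-(w.ε * w.Rσ)) + 2 * w.KbarΓ * α / w.R)) ≤ θ)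
    (hsmallKθ : w.KbarC * (m * (1 + 2 / κb) ^ ν) * (θ * (m * (1 + 2 / kap'') ^ ν)) < 1)
    {cE g : ℝ} (hc0 : 0 ≤ cE) (hc : ∀ Z t φ k, (𝒦 Z t φ).hC.1.eigenvalues k ≤ cE)
    (hαc : (2 * (θ * (m * (1 + 2 / kap'') ^ ν)) + (γ₂ + a₂₀)) * cE ≤ 1 / 2) (hg : 0 ≤ g)
    (hΓq : ∀ Z, ∀ t ∈ terms L M Z, ∀ φ, φ ∈ W.sp2 Z → ∀ X : (𝒦 Z t φ).Λ ⊕ (𝒦 Z t φ).C₀ → ℝ,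
      ((𝒦 Z t φ).Γ₀ *ᵥ X) ⬝ᵥ ((𝒦 Z t φ).C *ᵥ ((𝒦 Z t φ).Γ₀ *ᵥ X)) ≤ g * (X ⬝ᵥ X))
    (hsmall : (2 * (θ * (m * (1 + 2 / kap'') ^ ν)) + (γ₂ + a₂₀)) * (1 + 2 * cE * g) ≤ 1 / 2)
    {a a₅ : ℝ} (hPa : a ≤ γ₂ * rP ^ 2)
    (hvol : ∀ Z, ∀ t ∈ terms L M Z, ∀ φ, φ ∈ W.sp2 Z →
      2 * (w.KbarC * (m * (1 + 2 / κb) ^ ν) * (θ * (m * (1 + 2 / kap'') ^ ν))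
              * (1 + (1 - w.KbarC * (m * (1 + 2 / κb) ^ ν) * (θ * (m * (1 + 2 / kap'') ^ ν)))⁻¹) / 2)
          * (Fintype.card (𝒦 Z t φ).Λ : ℝ)
        + w₂₀ + (2 * (θ * (m * (1 + 2 / kap'') ^ ν)) + (γ₂ + a₂₀)) * cE * (Fintype.card (𝒦 Z t φ).Λ : ℝ)
        + (2 * (θ * (m * (1 + 2 / kap'') ^ ν)) + (γ₂ + a₂₀)) * (1 + 2 * cE * g)
          * (Fintype.card ((𝒦 Z t φ).Λ ⊕ (𝒦 Z t φ).C₀) : ℝ)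
        ≤ a₅ * ((Z.1).card : ℝ))
    -- Lemma 3's and (2.39)–(2.41)'s numbers, verbatim as in T17
    {a₂ a₂' Aabs : ℝ}
    (hα₆ : 0 < c.α₆) (hε₀ : 0 ≤ c.eps2) (hδ : 0 ≤ c.δ) (hδ7 : 0 ≤ 1 - 7 * c.δ) (hκ : 0 ≤ c.κ) (ha : 0 ≤ a)
    (hR15 : c.R15) (hR16 : 18 * ((1 - 4 * c.δ) * c.κ) ≤ a / 20) (hR16' : 4 * c.κ ≤ a / 20)
    (hR17 : Real.exp (-(a / 20)) ≤ c.eps2) (h231 : 2 * (4 : ℝ) * (M : ℝ) ^ 4 * Real.exp (-(a / 10)) ≤ a / 20)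
    (ha₂ : 0 ≤ a₂) (hκ229 : kappa₀ 64 8 + a₂ ≤ c.δ * c.κ)
    (hsm229 : c.α₆ * Real.exp a₂ * K₀ 64 8 * 64 ≤ a₂)
    (habsk : Real.exp (-(a / 20)) * 64 ≤ c.δ * c.κ)
    (h18half : B13Step237.R18half c (K₀ 64 8 * Real.exp (Real.exp (-(a / 20)) * 64)))
    (h18 : B13Step237.R18sharp c (K₀ 64 8 * Real.exp (Real.exp (-(a / 20)) * 64)) ((c.L : ℝ) / 2))
    (ha₂' : 0 ≤ a₂') (hκ229' : kappa₀ 64 8 + a₂' ≤ c.δ * ((c.L : ℝ) / 2) * c.κ)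
    (hsm229' : c.α₆ * Real.exp a₂' * K₀ 64 8 * 64 ≤ a₂')
    (hR20 : 18 * ((1 - 7 * c.δ) * ((c.L : ℝ) / 2) * c.κ) ≤ (c.κ₁ - 1) / 2)
    (ha₅ : 0 ≤ a₅) (habs : a₅ + Real.exp (-((c.κ₁ - 1) / 2)) ≤ Aabs)
    (hAc : Aabs * 64 ≤ c.δ * ((c.L : ℝ) / 2) * c.κ)
    (hC3 : B13Step237.bracketF c (K₀ 64 8 * Real.exp (Real.exp (-(a / 20)) * 64)) / c.α₆ *
      Real.exp (Aabs * 64) ≤ c.C3act * c.ε₁)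
    -- the members' activities are the sums of the (2.14)-terms read from the records; (2.13); space restriction
    {H : B → TDom 4 N' → W.Φ → ℂ}
    (hH : ∀ b ∈ ball (0 : B) α, ∀ (Z : TDom 4 N') (φ : W.Φ), φ ∈ W.sp2 Z → H b Z φ = ∑ t ∈ terms L M Z,
      term214 r (lZ Z t) (lD t) (core214 (fun σ => (𝒦 Z t φ).A2 σ b) (Γ Z t φ b)
        (F214 t.2.card (χY₀ Z t φ) (χcP Z t φ) (Dfam Z t) (Vk Z t φ b))) 0 0)
    (hsp : ∀ X Z : TDom 4 N', ∀ φ, Z.1 ⊆ X.1 → φ ∈ W.sp2 X → φ ∈ W.sp2 Z)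
    {E : B → TDom 4 N' → W.Φ → ℂ}
    (h213 : ∀ b ∈ ball (0 : B) α, ∀ (X : TDom 4 N') (φ : W.Φ), φ ∈ W.sp2 X →
      E b X φ = locE (TTouch (d := 4) (N := N')) (fun Z : TDom 4 N' => Z.1) (fun Z => H b Z φ) X.1)
    (hAct : 0 ≤ c.C3act * c.ε₁) (hr₁ : 0 ≤ (1 - 10 * c.δ) * ((c.L : ℝ) / 2) * c.κ)
    (hlarge : (1 - 10 * c.δ) * ((c.L : ℝ) / 2) * c.κ + 2 * (64 * Real.log 162) + 2 ≤
      (1 - 8 * c.δ) * ((c.L : ℝ) / 2) * c.κ)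
    (hsmall41 : c.C3act * c.ε₁ * Real.exp (5 * ((1 - 10 * c.δ) * ((c.L : ℝ) / 2) * c.κ) + 1) * K₀ 64 8 * 9 * 64 ≤ 1)
    (hA₂ : Real.exp 1 * 9 * 64 * K₀ 64 8 ^ 2 ≤ c.A₂) :
    ∀ (X : TDom 4 N') (φ : W.Φ), φ ∈ W.sp2 X →
      DifferentiableOn ℂ (fun b => E b X φ) (ball (0 : B) α) ∧
        ∀ b ∈ ball (0 : B) α, ‖E b X φ‖ ≤
          c.A₂ * c.C3act * c.ε₁ * Real.exp (-((1 - 10 * c.δ) * ((c.L : ℝ) / 2) * c.κ * (tsys 4 N').dj X)) := by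
  -- the (2.14)-term families read from the records
  let P : (Z : TDom 4 N') → Finset (TDom 4 (L * N')) × Finset (TBond 4 M (L * N')) → W.Φ → B → ℂ :=
    fun Z t φ b => term214 r (lZ Z t) (lD t) (core214 (fun σ => (𝒦 Z t φ).A2 σ b) (Γ Z t φ b)
      (F214 t.2.card (χY₀ Z t φ) (χcP Z t φ) (Dfam Z t) (Vk Z t φ b))) 0 0
  -- T25 per term and configuration
  have key : ∀ (Z : TDom 4 N') (φ : W.Φ), φ ∈ W.sp2 Z → ∀ t ∈ terms L M Z,
      DifferentiableOn ℂ (P Z t φ) (ball (0 : B) α) ∧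
        ∀ b ∈ ball (0 : B) α, ‖P Z t φ b‖ ≤ weight L M c Z a t * Real.exp (a₅ * ((Z.1).card : ℝ)) := by
    intro Z φ hφ t ht
    exact hol_and_h226_torus_of_termWalkData_param c hκ₁ hα₆' Z t hpos hhalf hUτ hUtau hr hr' hsubτ (lZ Z t)
      (hlZ Z t) (lD t) (hlD t) (𝒦 Z t φ) hw hα (h𝒦 Z t ht φ hφ) (Γ Z t φ) (hlin Z t ht φ hφ) (χY₀ Z t φ)
      (χcP Z t φ) (hχ0 Z t φ) (hχc0 Z t φ) (Dfam Z t) (Vk Z t φ) (hAhol Z t ht φ hφ) (hGhol Z t ht φ hφ)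
      (hVholb Z t ht φ hφ) (hχm Z t φ) (hχcm Z t φ) (hVm Z t ht φ hφ) (hAs Z t ht φ hφ) (hA Z t ht φ hφ)
      (qP Z t φ) (h222 Z t φ) hγ₂ (hqP Z t φ) ha0 (h220U Z t ht φ hφ) (hm Z t φ) (hfibN Z t φ) hκa hκb h2 h1
      hkap'' hsm (hθR1le Z t φ) hsmallKθ hc0 (hc Z t φ) hαc hg (hΓq Z t ht φ hφ) hsmall hPa
      (hvol Z t ht φ hφ)
  exact differentiableOn_E_torus_param c hL hLc W P isOpen_ball (fun Z φ hφ t ht => (key Z φ hφ t ht).1)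
    (fun b hb Z φ hφ t ht => (key Z φ hφ t ht).2 b hb) hα₆ hε₀ hδ hδ7 hκ ha hR15 hR16 hR16' hR17 h231 ha₂ hκ229
    hsm229 habsk h18half h18 ha₂' hκ229' hsm229' hR20 ha₅ habs hAc hC3 hH hsp h213 hAct hr₁ hlarge hsmall41 hA₂

/-! ## §2. The pencil case `B = ℂ`: NE5's inequality at one paired scale from per-term walk records -/

/-- **NE5 AT ONE PAIRED SCALE FROM PER-TERM WALK RECORDS OVER `ℂ`** (the reading of §1 for the pencil): if the
parameter space is `ℂ` and the admissible size is a window `α > 1` (NE5: `α = s∕r_j`, run A = the member `0`, run B = the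
member `1`), then §1's conclusion for `b ↦ E^b(X)(φ)` gives the THREE per-scale inputs of T16
`TwoRunTorusNE5.ne5_of_torus_rates(_all_scales)` at that scale: the two one-run envelopes `‖E^0(X)(φ)‖ ≤ K`,
`‖E^1(X)(φ)‖ ≤ K` and the two-run rate `‖E^1(X)(φ) − E^0(X)(φ)‖ ≤ 2K∕α` (the Schwarz step
`TwoRunTorusRate.norm_sub_le_of_pencil`), `K = A₂C₃ε₁e^{−(1−10δ)½Lκd_{k+1}(X)}`.
[cite: Balaban1988RG2Cluster, (2.41) p.21; King1986, Thm 3.4 p.656, p.665] -/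
theorem torus_rates_of_output_pencil {α K : ℝ} (hα : 1 < α) {X : TDom 4 N'} {Φ : Type*} {φ : Φ}
    {E : ℂ → TDom 4 N' → Φ → ℂ}
    (h : DifferentiableOn ℂ (fun b => E b X φ) (ball (0 : ℂ) α) ∧ ∀ b ∈ ball (0 : ℂ) α, ‖E b X φ‖ ≤ K) :
    ‖E 0 X φ‖ ≤ K ∧ ‖E 1 X φ‖ ≤ K ∧ ‖E 1 X φ - E 0 X φ‖ ≤ 2 * K / α :=
  ⟨h.2 0 (mem_ball_self (one_pos.trans hα)), h.2 1 (by simpa using hα), norm_sub_le_of_pencil hα h.1 h.2⟩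

end Summit.QuantumFields.BalabanUV.T4Continuum.Spine.NE5.TwoRunTorusWalkOutput

end
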